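import Literature.NumberTheory.GelbartRogawski1991.UnitaryDualPairThetaLiftGaussianCharacter
import Literature.NumberTheory.Weil1964.ThetaWeightForms
import HarnessLib

-- As in the lineage (`UnitaryDualPairThetaKernelGaussian`, `…ThetaLiftGaussianCMLine`, `…ThetaLiftGaussianCharacter`;
-- ops-buildfix G11b-3): statements over the theta-kernel datum elaborate to very large types; elaborate sequentially.
set_option Elab.async false

/-!
# Theta lifts of automorphic characters: `χ`-covariance in the Schwartz variable and Fourier duality of the two lifts

Topic `NumberTheory/GelbartRogawski1991`; namespaces `Literature.NumberTheory.Weil1964.ThetaKernelDatum` (§0, generic)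
and `Literature.NumberTheory.GelbartRogawski1991.UnitaryDualPair` (§§1–2, the CM dual pairs of [GelbartRogawski1991]).
Continues `UnitaryDualPairThetaLiftGaussianCharacter` (there: for the CM pair `(U(diag d_V), U(⟨d_W⟩))` some
automorphic character `χ` of the compact abelian group `[U(⟨d_W⟩)]` has a non-zero theta lift `Θ_{Φ_G}(χ)`).
KERNEL file: THEOREMS ONLY (no definition, no instance, no named fact, no `sorry`).

For a dual-pair theta datum `M` (Weil's `θ`-kernel `θ_Φ` on `(GU ⧸ ΓU) × (G ⧸ Γ)`, both compact) with `Γ` NORMAL in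
`G` — so that `G ⧸ Γ` is a compact group and its continuous unitary characters `χ : PontryaginDual (G ⧸ Γ)` are the
"automorphic characters" of the second member — the theta lift `Θ^{μ}_Φ(χ) = ∫ θ_Φ(·, q) χ(q) dμ(q)`
[FleigEtAl2018, (12.37)] of a character and the opposite lift `Θᵗ^{ν}_Φ(F) = ∫ θ_Φ(ξ, ·) F(ξ) dν(ξ)`
[FleigEtAl2018, (12.38)] satisfy:

* §0.1 `thetaLift_act_right_charCM` — **`χ`-COVARIANCE IN THE SCHWARTZ VARIABLE**: for `μ` `G`-invariant and
  every `h ∈ G`, `Θ_{s(1,h)Φ}(χ) = χ(h̄) · Θ_Φ(χ)` (`h̄` the class of `h` in `G ⧸ Γ`): the map `Φ ↦ Θ_Φ(χ)` transforms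
  under the Weil action of the second member through the character `χ ∘ (G → G ⧸ Γ)`; for a theta-linear datum
  (`thetaLift_act_right_sub_smul_charCM`) it therefore KILLS `s(1,h)Φ - χ(h̄)Φ`, i.e. factors through the
  `(G, χ)`-co-invariants of the Weil representation — the shape of Howe's "big theta lift" of the character;
* §0.2 `integral_star_charCM_mul_thetaLiftT` — **FOURIER DUALITY OF THE TWO LIFTS**: the `χ`-th Fourier
  coefficient of the opposite lift is the pairing with the lift of `χ̄`:
  `∫ conj χ(q) Θᵗ_Φ(F)(q) dμ(q) = ∫ Θ_Φ(χ⁻¹)(ξ) F(ξ) dν(ξ)` (adjointness of the two lifts, tree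
  `integral_thetaLift_mul`); hence (`exists_integral_star_charCM_mul_thetaLiftT_ne_zero_iff`, `ν` charging open
  sets) **`χ` OCCURS in `Θᵗ_Φ(F)` for some `F ∈ C(GU ⧸ ΓU, ℂ)` iff `Θ_Φ(χ⁻¹) ≠ 0`**, and
  (`exists_thetaLiftT_ne_zero`) the opposite correspondence `Θᵗ_Φ` is non-zero as soon as one character has a
  non-zero lift.

§1 `cmThetaKernelDatum_thetaLinear` — the theta-kernel datum of every CM dual pair `(U(diag d_V), U(diag d_W))`
of the lineage IS theta-linear (`WeilThetaDatum.ThetaLinear`, the standing hypothesis `hlin` of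
`Weil1964.ThetaWeightForms` / `Automorphic.ThetaClassSupply` / `…ThetaFormsRationalTranslate`), since its theta
function is the linear theta distribution `thetaDistLM` composed with the linear Weil action `cmPairRep`.

§2 the CM LINE `M = 1` (`[U(⟨d_W⟩)]` a compact ABELIAN group, `U(⟨d_W⟩)(L⁺)` normal): the instances
`cmThetaKernelDatum_line_thetaLift_cmPairRep_charCM` (covariance `Θ_{ω(1,h)Φ}(χ) = χ(h̄) Θ_Φ(χ)` for every
invariant finite Borel measure), `…_cmPairRep_sub_smul_charCM` (co-invariants), `…_integral_star_charCM_mul_thetaLiftT`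
(Fourier duality) and `…_iff`; and, fed by `UnitaryDualPairThetaLiftGaussianCharacter` §2, **modulo
[GelbartRogawski1991, Prop. 3.1.1] (`hGR`) only: SOME AUTOMORPHIC CHARACTER OF THE CM LINE OCCURS IN THE THETA LIFTS
OF THE GAUSSIAN LEVEL FROM `[U(diag d_V)]`** (`cmThetaKernelDatum_line_exists_character_fourierCoeff_thetaLiftT_gaussSB_ne_zero`),
so the opposite theta correspondence `Θᵗ_{Φ_G} : C([U(diag d_V)]) → C([U(⟨d_W⟩)])` is not identically zero
(`cmThetaKernelDatum_line_exists_thetaLiftT_gaussSB_ne_zero`) — the second of FGKP's "prototypical questions"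
("Is `Θ_φ` non-zero?", p. 296) for the lift (12.38) of this pair.

## References
* P. Fleig, H. P. A. Gustafsson, A. Kleinschmidt, D. Persson, *Eisenstein Series and Automorphic Representations* (2018),
  §12.3 Definition 12.5 (12.37)–(12.38), printed p. 296 [FleigEtAl2018].
* S. Gelbart, J. Rogawski, *L-functions and Fourier–Jacobi coefficients for the unitary group U(3)*, Invent. Math. 105
  (1991), §3.1 Prop. 3.1.1 p. 455, §3.2 p. 457 [GelbartRogawski1991].
* A. Weil, *Sur certains groupes d'opérateurs unitaires*, Acta Math. 111 (1964), Chap. III n° 41 Thm 6 p. 193 [Weil1964].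
* A. Deitmar, S. Echterhoff, *Principles of Harmonic Analysis*, 2nd ed. (2014), Prop. 3.5.2 [DeitmarEchterhoff2014].

## Provenance
Lane `lit-hodgefound` (HOME `run/shared/lean/pub/lit-hodgefound/`), prover seat `lit-hodgefound-p05` generation 5, fourth
file (follow-up (b) recorded under the seat's Q370, in the form the abstract splitting `hGR` allows).
-/

set_option autoImplicit false

noncomputable section

open scoped Matrix ComplexConjugate ComplexOrder
open NumberField NumberField.mixedEmbedding IsDedekindDomain
open _root_.MeasureTheory
open Literature.NumberTheory.Automorphic
open Literature.AlgebraicGeometry.ShimuraVarieties (hermForm)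
open Literature.RepresentationTheory.CompactGroups

/-! ## §0. Generic dual-pair theta datum with `Γ` normal: covariance and Fourier duality for characters -/

namespace Literature.NumberTheory.Weil1964.ThetaKernelDatum

variable {Mp : Type*} {SX : Type*} [TopologicalSpace Mp] [Group Mp] [TopologicalSpace SX]
variable {GU : Type*} [Group GU] [TopologicalSpace GU] [IsTopologicalGroup GU] {ΓU : Subgroup GU}
variable {G : Type*} [Group G] [TopologicalSpace G] [IsTopologicalGroup G] {Γ : Subgroup G}
variable (M : ThetaKernelDatum Mp SX GU ΓU G Γ)
variable [CompactSpace (GU ⧸ ΓU)] [CompactSpace (G ⧸ Γ)] [MeasurableSpace (G ⧸ Γ)] [BorelSpace (G ⧸ Γ)]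
  (μ : Measure (G ⧸ Γ)) [IsFiniteMeasure μ] [Γ.Normal]

section Covariance

variable [SMulInvariantMeasure G (G ⧸ Γ) μ]

/-- **`χ`-covariance of the theta lift of a character in the Schwartz variable.**  For a dual-pair theta datum
whose second member `G ⧸ Γ` is a (compact) GROUP (`Γ` normal), a `G`-invariant finite Borel measure `μ` on it, a
continuous unitary character `χ` of `G ⧸ Γ` and `h ∈ G`:
`Θ_{s(1,h)Φ}(χ) = χ(h̄) · Θ_Φ(χ)`, `h̄ = hΓ` — from the equivariance `Θ_{s(1,h)Φ}(λ(h) f) = Θ_Φ(f)` of the lift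
(tree `thetaLift_act_right`, a change of variables in (12.37) using the invariance of `dh`) and
`λ(h) χ = χ(h̄)⁻¹ χ`. [cite: FleigEtAl2018, §12.3 Definition 12.5 (12.37), p. 296] -/
theorem thetaLift_act_right_charCM (Φ : SX) (h : G) (χ : PontryaginDual (G ⧸ Γ)) :
    M.thetaLift μ (M.W.act (M.s (1, h)) Φ) (charCM χ) =
      ((χ (QuotientGroup.mk h) : Circle) : ℂ) • M.thetaLift μ Φ (charCM χ) := by
  have hc0 : ((χ (QuotientGroup.mk h) : Circle) : ℂ) ≠ 0 := Circle.coe_ne_zero _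
  have hcinv : ((χ (QuotientGroup.mk h⁻¹) : Circle) : ℂ) = (((χ (QuotientGroup.mk h) : Circle) : ℂ))⁻¹ := by
    rw [QuotientGroup.mk_inv, map_inv, Circle.coe_inv]
  have key := M.thetaLift_act_right μ Φ h (f := charCM χ)
    (f' := (((χ (QuotientGroup.mk h) : Circle) : ℂ))⁻¹ • charCM χ) (fun q => by
      induction q using QuotientGroup.induction_on with
      | H x =>
        simp only [ContinuousMap.smul_apply, smul_eq_mul, charCM_apply, MulAction.Quotient.smul_coe,
          QuotientGroup.mk_mul, map_mul, Circle.coe_mul, hcinv])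
  rw [thetaLift_smul] at key
  rw [← key, smul_smul, mul_inv_cancel₀ hc0, one_smul]

/-- **The character theta lift factors through the `(G, χ)`-co-invariants of the Weil representation** (theta-linear
datum): `Θ_{s(1,h)Φ - χ(h̄)Φ}(χ) = 0` for all `h ∈ G`, `Φ` — the linear map `Φ ↦ Θ_Φ(χ)` kills the span of the
`s(1,h)Φ - χ(h̄)Φ`. [cite: FleigEtAl2018, §12.3 Definition 12.5 (12.37), p. 296] -/
theorem thetaLift_act_right_sub_smul_charCM [AddCommGroup SX] [Module ℂ SX] (hlin : M.W.ThetaLinear) (Φ : SX)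
    (h : G) (χ : PontryaginDual (G ⧸ Γ)) :
    M.thetaLift μ (M.W.act (M.s (1, h)) Φ - ((χ (QuotientGroup.mk h) : Circle) : ℂ) • Φ) (charCM χ) = 0 := by
  rw [sub_eq_add_neg, ← neg_smul, M.thetaLift_add_left μ hlin, M.thetaLift_smul_left μ hlin,
    M.thetaLift_act_right_charCM μ Φ h χ, neg_smul, add_neg_cancel]

/-- Rational elements act trivially: `Θ_{s(1,γ)Φ}(χ) = Θ_Φ(χ)` for `γ ∈ Γ` (`χ(γ̄) = χ(1) = 1`).
[cite: FleigEtAl2018, §12.3 Definition 12.5 (12.37), p. 296] -/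
theorem thetaLift_act_right_charCM_of_mem (Φ : SX) {γ : G} (hγ : γ ∈ Γ) (χ : PontryaginDual (G ⧸ Γ)) :
    M.thetaLift μ (M.W.act (M.s (1, γ)) Φ) (charCM χ) = M.thetaLift μ Φ (charCM χ) := by
  rw [M.thetaLift_act_right_charCM μ Φ γ χ, (QuotientGroup.eq_one_iff γ).mpr hγ, map_one, Circle.coe_one,
    one_smul]

end Covariance

section Fourier

variable [MeasurableSpace (GU ⧸ ΓU)] [BorelSpace (GU ⧸ ΓU)] (ν : Measure (GU ⧸ ΓU)) [IsFiniteMeasure ν]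

/-- **Fourier duality of the two theta lifts.**  The `χ`-th Fourier coefficient (w.r.t. `μ`) of the opposite lift
`Θᵗ_Φ(F)(q) = ∫ θ_Φ(ξ, q) F(ξ) dν(ξ)` [FleigEtAl2018, (12.38)] of `F ∈ C(GU ⧸ ΓU, ℂ)` is the `ν`-pairing of `F`
with the theta lift [FleigEtAl2018, (12.37)] of the conjugate character:
`∫ conj χ(q) · Θᵗ_Φ(F)(q) dμ(q) = ∫ Θ_Φ(χ⁻¹)(ξ) · F(ξ) dν(ξ)` (adjointness of the two lifts — both are
integrals against the same continuous kernel on the compact product; `conj χ = χ⁻¹`).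
[cite: FleigEtAl2018, §12.3 Definition 12.5 (12.37)–(12.38), p. 296] -/
theorem integral_star_charCM_mul_thetaLiftT (Φ : SX) (F : C(GU ⧸ ΓU, ℂ)) (χ : PontryaginDual (G ⧸ Γ)) :
    ∫ q, star (charCM χ q) * M.thetaLiftT ν Φ F q ∂μ = ∫ ξ, M.thetaLift μ Φ (charCM χ⁻¹) ξ * F ξ ∂ν := by
  rw [M.integral_thetaLift_mul ν μ Φ (charCM χ⁻¹) F, ← star_charCM]
  rfl

/-- If `Θ_Φ(χ⁻¹) = 0` then `χ` does not occur in any opposite lift `Θᵗ_Φ(F)`: all the `χ`-th Fourier coefficients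
vanish. [cite: FleigEtAl2018, §12.3 Definition 12.5 (12.37)–(12.38), p. 296] -/
theorem integral_star_charCM_mul_thetaLiftT_eq_zero {Φ : SX} {χ : PontryaginDual (G ⧸ Γ)}
    (h0 : M.thetaLift μ Φ (charCM χ⁻¹) = 0) (F : C(GU ⧸ ΓU, ℂ)) :
    ∫ q, star (charCM χ q) * M.thetaLiftT ν Φ F q ∂μ = 0 := by
  rw [M.integral_star_charCM_mul_thetaLiftT μ ν Φ F χ, h0]
  simp

/-- **If `Θ_Φ(χ⁻¹) ≠ 0` then `χ` OCCURS in some opposite lift**: for `ν` charging open sets there is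
`F ∈ C(GU ⧸ ΓU, ℂ)` — namely `F = conj Θ_Φ(χ⁻¹)` — whose opposite lift `Θᵗ_Φ(F)` has non-zero `χ`-th Fourier
coefficient `∫ conj χ · Θᵗ_Φ(F) dμ = ∫ |Θ_Φ(χ⁻¹)|² dν > 0`.
[cite: FleigEtAl2018, §12.3 Definition 12.5 (12.37)–(12.38), p. 296] -/
theorem exists_integral_star_charCM_mul_thetaLiftT_ne_zero [ν.IsOpenPosMeasure] {Φ : SX}
    {χ : PontryaginDual (G ⧸ Γ)} (hne : M.thetaLift μ Φ (charCM χ⁻¹) ≠ 0) :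
    ∃ F : C(GU ⧸ ΓU, ℂ), ∫ q, star (charCM χ q) * M.thetaLiftT ν Φ F q ∂μ ≠ 0 := by
  set Θ := M.thetaLift μ Φ (charCM χ⁻¹) with hΘ
  refine ⟨star Θ, ?_⟩
  rw [M.integral_star_charCM_mul_thetaLiftT μ ν, ← hΘ]
  have hsq : ∫ ξ, Θ ξ * (star Θ) ξ ∂ν = ((∫ ξ, ‖Θ ξ‖ ^ 2 ∂ν : ℝ) : ℂ) := by
    rw [← integral_complex_ofReal]
    congr 1
    funext ξ
    rw [ContinuousMap.star_apply, Complex.star_def, Complex.mul_conj']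
    push_cast
    ring
  obtain ⟨ξ₀, hξ₀'⟩ := DFunLike.ne_iff.mp hne
  have hξ₀ : Θ ξ₀ ≠ 0 := fun h0 => hξ₀' (by rw [h0]; rfl)
  have hcont : Continuous fun ξ => ‖Θ ξ‖ ^ 2 := by fun_prop
  have hpos : 0 < ∫ ξ, ‖Θ ξ‖ ^ 2 ∂ν :=
    hcont.integral_pos_of_hasCompactSupport_nonneg_nonzero (μ := ν) (HasCompactSupport.of_compactSpace _)
      (fun ξ => sq_nonneg _) (pow_ne_zero 2 (norm_ne_zero_iff.mpr hξ₀))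
  rw [hsq]
  exact_mod_cast hpos.ne'

/-- **`χ` occurs in the opposite theta lifts `Θᵗ_Φ(F)`, `F ∈ C(GU ⧸ ΓU, ℂ)`, iff `Θ_Φ(χ⁻¹) ≠ 0`** (`ν` charging
open sets): the Fourier support of the opposite correspondence at level `Φ` is the set of conjugates of the
characters with non-zero theta lift. [cite: FleigEtAl2018, §12.3 Definition 12.5 (12.37)–(12.38), p. 296] -/
theorem exists_integral_star_charCM_mul_thetaLiftT_ne_zero_iff [ν.IsOpenPosMeasure] (Φ : SX)
    (χ : PontryaginDual (G ⧸ Γ)) :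
    (∃ F : C(GU ⧸ ΓU, ℂ), ∫ q, star (charCM χ q) * M.thetaLiftT ν Φ F q ∂μ ≠ 0) ↔
      M.thetaLift μ Φ (charCM χ⁻¹) ≠ 0 :=
  ⟨fun ⟨F, hF⟩ h0 => hF (M.integral_star_charCM_mul_thetaLiftT_eq_zero μ ν h0 F),
    M.exists_integral_star_charCM_mul_thetaLiftT_ne_zero μ ν⟩

/-- **Non-vanishing transfers to the opposite correspondence**: if one character `χ` has `Θ_Φ(χ) ≠ 0` then
`Θᵗ_Φ(F) ≠ 0` for some `F ∈ C(GU ⧸ ΓU, ℂ)` (`ν` charging open sets) — FGKP's question "Is `Θ_{φ'}` non-zero?"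
for the lift (12.38), answered from the lift (12.37). [cite: FleigEtAl2018, §12.3 Definition 12.5 (12.37)–(12.38),
p. 296] -/
theorem exists_thetaLiftT_ne_zero [ν.IsOpenPosMeasure] {Φ : SX} {χ : PontryaginDual (G ⧸ Γ)}
    (hne : M.thetaLift μ Φ (charCM χ) ≠ 0) : ∃ F : C(GU ⧸ ΓU, ℂ), M.thetaLiftT ν Φ F ≠ 0 := by
  obtain ⟨F, hF⟩ :=
    M.exists_integral_star_charCM_mul_thetaLiftT_ne_zero μ ν (Φ := Φ) (χ := χ⁻¹) (by rwa [inv_inv])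
  refine ⟨F, fun h => hF ?_⟩
  rw [h]
  simp

end Fourier

end Literature.NumberTheory.Weil1964.ThetaKernelDatum

namespace Literature.NumberTheory.GelbartRogawski1991

namespace UnitaryDualPair

open Literature.NumberTheory.Weil1964

/-! ## §1. The theta-kernel datum of a CM dual pair is theta-linear -/

section Linear

variable (L : Type) [Field L] [NumberField L] [IsCMField L] {N M n : ℕ} (e : Fin N × Fin M ≃ Fin n)
variable (dV : Fin N → L) (hdV : ∀ i, IsCMField.complexConj L (dV i) = dV i) (hdV0 : ∀ i, dV i ≠ 0)
variable (dW : Fin M → L) (hdW : ∀ i, IsCMField.complexConj L (dW i) = dW i) (hdW0 : ∀ i, dW i ≠ 0)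
variable (hGR : (cmSplittingDatum L e dV hdV hdV0 dW hdW hdW0).CompatibleSplitting)
  (hρ : HasThetaMajorants fun
    (p : ↥(UnitaryGroup.adelic ↥(maximalRealSubfield L) L (IsCMField.complexConj L) N (Matrix.diagonal dV)) ×
      ↥(UnitaryGroup.adelic ↥(maximalRealSubfield L) L (IsCMField.complexConj L) M (Matrix.diagonal dW)))
    (Φ : piSchwartzBruhat ↥(maximalRealSubfield L) (Fin n)) =>
      adelicMpCont.omega ↥(maximalRealSubfield L) (Fin n)
        (adelicGram ↥(maximalRealSubfield L) e (realDiagonal L dV hdV) (realDiagonal L dW hdW))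
        (cmPairSplitting L e dV hdV hdV0 dW hdW hdW0 hGR p) Φ)
  (SK : Set (piSchwartzBruhat ↥(maximalRealSubfield L) (Fin n)))
  (hSK : ∀ (h : ↥(UnitaryGroup.adelic ↥(maximalRealSubfield L) L (IsCMField.complexConj L) M (Matrix.diagonal dW)))
    (Φ : piSchwartzBruhat ↥(maximalRealSubfield L) (Fin n)), Φ ∈ SK →
      cmPairRep L e dV hdV hdV0 dW hdW hdW0 hGR (1, h) Φ ∈ SK)

/-- **The theta-kernel datum of the CM dual pair `(U(diag d_V), U(diag d_W))` is theta-linear**: each `Φ ↦ Θ_Φ(S)` is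
`ℂ`-linear on `𝒮(𝕎_𝔸)` — it is Weil's linear theta distribution `thetaDistLM` after the linear operator
`ω_ψ(s_pair S) = cmPairRep S` (this discharges the standing hypothesis `WeilThetaDatum.ThetaLinear` of the tree's
`Weil1964.ThetaWeightForms` for these data). [cite: Weil1964, Chap. III n° 41 Thm 6 p. 193] -/
theorem cmThetaKernelDatum_thetaLinear :
    WeilThetaDatum.ThetaLinear (SX := ↥(piSchwartzBruhat ↥(maximalRealSubfield L) (Fin n)))
      (cmThetaKernelDatum L e dV hdV hdV0 dW hdW hdW0 hGR hρ SK hSK).W := fun S =>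
  ((thetaDistLM ↥(maximalRealSubfield L) (Fin n)).comp (cmPairRep L e dV hdV hdV0 dW hdW hdW0 hGR S)).isLinear

end Linear

/-! ## §2. The CM line `M = 1`: automorphic characters of `[U(⟨d_W⟩)]` -/

section Line

variable (L : Type) [Field L] [NumberField L] [IsCMField L]

/-- `U(⟨d_W⟩)(𝔸_{L⁺}) ⊂ GL₁(𝔸_L)` is commutative (`1 × 1` matrices over a commutative ring). [folklore] -/
private theorem adelic_line_mul_comm (dW : Fin 1 → L)
    (a b : ↥(UnitaryGroup.adelic ↥(maximalRealSubfield L) L (IsCMField.complexConj L) 1 (Matrix.diagonal dW))) :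
    a * b = b * a := by
  apply Subtype.ext
  show (a : GL (Fin 1) (AdeleRing (𝓞 L) L)) * b = b * a
  ext i j
  simp [Units.val_mul, Matrix.mul_apply, Subsingleton.elim i 0, Subsingleton.elim j 0, mul_comm]

/-- The rational points `U(⟨d_W⟩)(L⁺)` form a NORMAL subgroup of the commutative group `U(⟨d_W⟩)(𝔸_{L⁺})`.
[folklore] -/
private theorem normal_range_toAdelic_line (dW : Fin 1 → L) :
    (UnitaryGroup.toAdelic ↥(maximalRealSubfield L) L (IsCMField.complexConj L) 1 (Matrix.diagonal dW)).range.Normal :=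
  ⟨fun m hm g => by rwa [adelic_line_mul_comm L dW g m, mul_inv_cancel_right]⟩

variable {N n : ℕ} (e : Fin N × Fin 1 ≃ Fin n)
variable (dV : Fin N → L) (hdV : ∀ i, IsCMField.complexConj L (dV i) = dV i) (hdV0 : ∀ i, dV i ≠ 0)
variable (dW : Fin 1 → L) (hdW : ∀ i, IsCMField.complexConj L (dW i) = dW i) (hdW0 : ∀ i, dW i ≠ 0)
variable (hGR : (cmSplittingDatum L e dV hdV hdV0 dW hdW hdW0).CompatibleSplitting)
  (hρ : HasThetaMajorants fun
    (p : ↥(UnitaryGroup.adelic ↥(maximalRealSubfield L) L (IsCMField.complexConj L) N (Matrix.diagonal dV)) ×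
      ↥(UnitaryGroup.adelic ↥(maximalRealSubfield L) L (IsCMField.complexConj L) 1 (Matrix.diagonal dW)))
    (Φ : piSchwartzBruhat ↥(maximalRealSubfield L) (Fin n)) =>
      adelicMpCont.omega ↥(maximalRealSubfield L) (Fin n)
        (adelicGram ↥(maximalRealSubfield L) e (realDiagonal L dV hdV) (realDiagonal L dW hdW))
        (cmPairSplitting L e dV hdV hdV0 dW hdW hdW0 hGR p) Φ)
  (SK : Set (piSchwartzBruhat ↥(maximalRealSubfield L) (Fin n)))
  (hSK : ∀ (h : ↥(UnitaryGroup.adelic ↥(maximalRealSubfield L) L (IsCMField.complexConj L) 1 (Matrix.diagonal dW)))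
    (Φ : piSchwartzBruhat ↥(maximalRealSubfield L) (Fin n)), Φ ∈ SK →
      cmPairRep L e dV hdV hdV0 dW hdW hdW0 hGR (1, h) Φ ∈ SK)

/-- **`χ`-COVARIANCE OF THE CHARACTER THETA LIFT OF THE CM LINE**: for the CM pair `(U(diag d_V), U(⟨d_W⟩))`, every
finite `U(⟨d_W⟩)(𝔸_{L⁺})`-INVARIANT Borel measure `μ` on the compact abelian group `[U(⟨d_W⟩)]`, every automorphic
character `χ : PontryaginDual [U(⟨d_W⟩)]`, every Schwartz–Bruhat `Φ` and every `h ∈ U(⟨d_W⟩)(𝔸_{L⁺})`: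
`Θ_{ω_ψ(s_pair(1,h))Φ}(χ) = χ(h̄) · Θ_Φ(χ)` — the map `Φ ↦ Θ_Φ(χ) ∈ C([U(diag d_V)], ℂ)` is
`(U(⟨d_W⟩)(𝔸_{L⁺}), χ ∘ quot)`-covariant (any majorant witness `hρ`, any index set `SK`; invariant measures are
supplied by `UnitaryDualPairThetaLiftGaussianCharacter` §1 and by the Haar measure of `[U(⟨d_W⟩)]`).
[cite: GelbartRogawski1991, §3.2 p. 457; FleigEtAl2018, §12.3 Definition 12.5 (12.37), p. 296] -/
theorem cmThetaKernelDatum_line_thetaLift_cmPairRep_charCM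
    [CompactSpace (↥(UnitaryGroup.adelic ↥(maximalRealSubfield L) L (IsCMField.complexConj L) N (Matrix.diagonal dV)) ⧸
      (UnitaryGroup.toAdelic ↥(maximalRealSubfield L) L (IsCMField.complexConj L) N (Matrix.diagonal dV)).range)]
    [MeasurableSpace (↥(UnitaryGroup.adelic ↥(maximalRealSubfield L) L (IsCMField.complexConj L) 1 (Matrix.diagonal dW)) ⧸
      (UnitaryGroup.toAdelic ↥(maximalRealSubfield L) L (IsCMField.complexConj L) 1 (Matrix.diagonal dW)).range)]
    [BorelSpace (↥(UnitaryGroup.adelic ↥(maximalRealSubfield L) L (IsCMField.complexConj L) 1 (Matrix.diagonal dW)) ⧸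
      (UnitaryGroup.toAdelic ↥(maximalRealSubfield L) L (IsCMField.complexConj L) 1 (Matrix.diagonal dW)).range)]
    (μ : Measure (↥(UnitaryGroup.adelic ↥(maximalRealSubfield L) L (IsCMField.complexConj L) 1 (Matrix.diagonal dW)) ⧸
      (UnitaryGroup.toAdelic ↥(maximalRealSubfield L) L (IsCMField.complexConj L) 1 (Matrix.diagonal dW)).range))
    [IsFiniteMeasure μ]
    [SMulInvariantMeasure ↥(UnitaryGroup.adelic ↥(maximalRealSubfield L) L (IsCMField.complexConj L) 1 (Matrix.diagonal dW))
      (↥(UnitaryGroup.adelic ↥(maximalRealSubfield L) L (IsCMField.complexConj L) 1 (Matrix.diagonal dW)) ⧸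
        (UnitaryGroup.toAdelic ↥(maximalRealSubfield L) L (IsCMField.complexConj L) 1 (Matrix.diagonal dW)).range) μ]
    (Φ : piSchwartzBruhat ↥(maximalRealSubfield L) (Fin n))
    (h : ↥(UnitaryGroup.adelic ↥(maximalRealSubfield L) L (IsCMField.complexConj L) 1 (Matrix.diagonal dW))) :
    haveI := normal_range_toAdelic_line L dW
    ∀ χ : PontryaginDual (↥(UnitaryGroup.adelic ↥(maximalRealSubfield L) L (IsCMField.complexConj L) 1
        (Matrix.diagonal dW)) ⧸ (UnitaryGroup.toAdelic ↥(maximalRealSubfield L) L (IsCMField.complexConj L) 1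
        (Matrix.diagonal dW)).range),
      (cmThetaKernelDatum L e dV hdV hdV0 dW hdW hdW0 hGR hρ SK hSK).thetaLift μ
          (cmPairRep L e dV hdV hdV0 dW hdW hdW0 hGR (1, h) Φ) (charCM χ) =
        ((χ (QuotientGroup.mk h) : Circle) : ℂ) •
          (cmThetaKernelDatum L e dV hdV hdV0 dW hdW hdW0 hGR hρ SK hSK).thetaLift μ Φ (charCM χ) := by
  haveI := normal_range_toAdelic_line L dW
  intro χ
  haveI : CompactSpace (↥(UnitaryGroup.adelic ↥(maximalRealSubfield L) L (IsCMField.complexConj L) 1 (Matrix.diagonal dW)) ⧸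
      (UnitaryGroup.toAdelic ↥(maximalRealSubfield L) L (IsCMField.complexConj L) 1 (Matrix.diagonal dW)).range) :=
    compactSpace_quotient_range_toAdelic_line L dW hdW hdW0
  exact ThetaKernelDatum.thetaLift_act_right_charCM
    (cmThetaKernelDatum L e dV hdV hdV0 dW hdW hdW0 hGR hρ SK hSK) μ Φ h χ

/-- **The character theta lift of the CM line factors through the `(U(⟨d_W⟩)(𝔸_{L⁺}), χ)`-co-invariants of the
Weil representation `ω_ψ ∘ s_pair`**: `Θ_{ω(1,h)Φ - χ(h̄)Φ}(χ) = 0` for all `h`, `Φ` (invariant `μ`; the datum is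
theta-linear by `cmThetaKernelDatum_thetaLinear`). [cite: GelbartRogawski1991, §3.2 p. 457; FleigEtAl2018, §12.3
Definition 12.5 (12.37), p. 296] -/
theorem cmThetaKernelDatum_line_thetaLift_cmPairRep_sub_smul_charCM
    [CompactSpace (↥(UnitaryGroup.adelic ↥(maximalRealSubfield L) L (IsCMField.complexConj L) N (Matrix.diagonal dV)) ⧸
      (UnitaryGroup.toAdelic ↥(maximalRealSubfield L) L (IsCMField.complexConj L) N (Matrix.diagonal dV)).range)]
    [MeasurableSpace (↥(UnitaryGroup.adelic ↥(maximalRealSubfield L) L (IsCMField.complexConj L) 1 (Matrix.diagonal dW)) ⧸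
      (UnitaryGroup.toAdelic ↥(maximalRealSubfield L) L (IsCMField.complexConj L) 1 (Matrix.diagonal dW)).range)]
    [BorelSpace (↥(UnitaryGroup.adelic ↥(maximalRealSubfield L) L (IsCMField.complexConj L) 1 (Matrix.diagonal dW)) ⧸
      (UnitaryGroup.toAdelic ↥(maximalRealSubfield L) L (IsCMField.complexConj L) 1 (Matrix.diagonal dW)).range)]
    (μ : Measure (↥(UnitaryGroup.adelic ↥(maximalRealSubfield L) L (IsCMField.complexConj L) 1 (Matrix.diagonal dW)) ⧸
      (UnitaryGroup.toAdelic ↥(maximalRealSubfield L) L (IsCMField.complexConj L) 1 (Matrix.diagonal dW)).range))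
    [IsFiniteMeasure μ]
    [SMulInvariantMeasure ↥(UnitaryGroup.adelic ↥(maximalRealSubfield L) L (IsCMField.complexConj L) 1 (Matrix.diagonal dW))
      (↥(UnitaryGroup.adelic ↥(maximalRealSubfield L) L (IsCMField.complexConj L) 1 (Matrix.diagonal dW)) ⧸
        (UnitaryGroup.toAdelic ↥(maximalRealSubfield L) L (IsCMField.complexConj L) 1 (Matrix.diagonal dW)).range) μ]
    (h : ↥(UnitaryGroup.adelic ↥(maximalRealSubfield L) L (IsCMField.complexConj L) 1 (Matrix.diagonal dW)))
    (Φ : piSchwartzBruhat ↥(maximalRealSubfield L) (Fin n)) :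
    haveI := normal_range_toAdelic_line L dW
    ∀ χ : PontryaginDual (↥(UnitaryGroup.adelic ↥(maximalRealSubfield L) L (IsCMField.complexConj L) 1
        (Matrix.diagonal dW)) ⧸ (UnitaryGroup.toAdelic ↥(maximalRealSubfield L) L (IsCMField.complexConj L) 1
        (Matrix.diagonal dW)).range),
      (cmThetaKernelDatum L e dV hdV hdV0 dW hdW hdW0 hGR hρ SK hSK).thetaLift μ
          ((cmPairRep L e dV hdV hdV0 dW hdW hdW0 hGR (1, h) Φ - ((χ (QuotientGroup.mk h) : Circle) : ℂ) • Φ :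
            ↥(piSchwartzBruhat ↥(maximalRealSubfield L) (Fin n))))
          (charCM χ) = 0 := by
  haveI := normal_range_toAdelic_line L dW
  intro χ
  haveI : CompactSpace (↥(UnitaryGroup.adelic ↥(maximalRealSubfield L) L (IsCMField.complexConj L) 1 (Matrix.diagonal dW)) ⧸
      (UnitaryGroup.toAdelic ↥(maximalRealSubfield L) L (IsCMField.complexConj L) 1 (Matrix.diagonal dW)).range) :=
    compactSpace_quotient_range_toAdelic_line L dW hdW hdW0
  -- the generic lemma at `SX := 𝒮(𝕎_𝔸)` with the theta-initial topology supplied explicitly (the `Module ℂ` instance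
  -- of the type synonym `ThetaTop` is not found by instance synthesis through `AddCommGroup`)
  exact @ThetaKernelDatum.thetaLift_act_right_sub_smul_charCM _ (↥(piSchwartzBruhat ↥(maximalRealSubfield L) (Fin n)))
    _ _ (WeilThetaDatum.instTopologicalSpaceThetaTop _) _ _ _ _ _ _ _ _ _ _
    (cmThetaKernelDatum L e dV hdV hdV0 dW hdW hdW0 hGR hρ SK hSK) _ _ _ _ μ _ _ _ _ _
    (cmThetaKernelDatum_thetaLinear L e dV hdV hdV0 dW hdW hdW0 hGR hρ SK hSK) Φ h χ

/-- **FOURIER DUALITY OF THE TWO THETA LIFTS OF THE CM PAIR `(U(diag d_V), U(⟨d_W⟩))`**: for finite Borel measures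
`ν` on `[U(diag d_V)]` and `μ` on `[U(⟨d_W⟩)]`, every `F ∈ C([U(diag d_V)], ℂ)` and every automorphic character `χ`
of the CM line, the `χ`-th Fourier coefficient of the opposite lift `Θᵗ_Φ(F) ∈ C([U(⟨d_W⟩)], ℂ)` is
`∫ conj χ · Θᵗ_Φ(F) dμ = ∫ Θ_Φ(χ⁻¹) · F dν`. [cite: GelbartRogawski1991, §3.2 p. 457; FleigEtAl2018, §12.3
Definition 12.5 (12.37)–(12.38), p. 296] -/
theorem cmThetaKernelDatum_line_integral_star_charCM_mul_thetaLiftT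
    [CompactSpace (↥(UnitaryGroup.adelic ↥(maximalRealSubfield L) L (IsCMField.complexConj L) N (Matrix.diagonal dV)) ⧸
      (UnitaryGroup.toAdelic ↥(maximalRealSubfield L) L (IsCMField.complexConj L) N (Matrix.diagonal dV)).range)]
    [MeasurableSpace (↥(UnitaryGroup.adelic ↥(maximalRealSubfield L) L (IsCMField.complexConj L) N (Matrix.diagonal dV)) ⧸
      (UnitaryGroup.toAdelic ↥(maximalRealSubfield L) L (IsCMField.complexConj L) N (Matrix.diagonal dV)).range)]
    [BorelSpace (↥(UnitaryGroup.adelic ↥(maximalRealSubfield L) L (IsCMField.complexConj L) N (Matrix.diagonal dV)) ⧸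
      (UnitaryGroup.toAdelic ↥(maximalRealSubfield L) L (IsCMField.complexConj L) N (Matrix.diagonal dV)).range)]
    (ν : Measure (↥(UnitaryGroup.adelic ↥(maximalRealSubfield L) L (IsCMField.complexConj L) N (Matrix.diagonal dV)) ⧸
      (UnitaryGroup.toAdelic ↥(maximalRealSubfield L) L (IsCMField.complexConj L) N (Matrix.diagonal dV)).range))
    [IsFiniteMeasure ν]
    [MeasurableSpace (↥(UnitaryGroup.adelic ↥(maximalRealSubfield L) L (IsCMField.complexConj L) 1 (Matrix.diagonal dW)) ⧸
      (UnitaryGroup.toAdelic ↥(maximalRealSubfield L) L (IsCMField.complexConj L) 1 (Matrix.diagonal dW)).range)]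
    [BorelSpace (↥(UnitaryGroup.adelic ↥(maximalRealSubfield L) L (IsCMField.complexConj L) 1 (Matrix.diagonal dW)) ⧸
      (UnitaryGroup.toAdelic ↥(maximalRealSubfield L) L (IsCMField.complexConj L) 1 (Matrix.diagonal dW)).range)]
    (μ : Measure (↥(UnitaryGroup.adelic ↥(maximalRealSubfield L) L (IsCMField.complexConj L) 1 (Matrix.diagonal dW)) ⧸
      (UnitaryGroup.toAdelic ↥(maximalRealSubfield L) L (IsCMField.complexConj L) 1 (Matrix.diagonal dW)).range))
    [IsFiniteMeasure μ] (Φ : piSchwartzBruhat ↥(maximalRealSubfield L) (Fin n))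
    (F : C(↥(UnitaryGroup.adelic ↥(maximalRealSubfield L) L (IsCMField.complexConj L) N (Matrix.diagonal dV)) ⧸
      (UnitaryGroup.toAdelic ↥(maximalRealSubfield L) L (IsCMField.complexConj L) N (Matrix.diagonal dV)).range, ℂ)) :
    haveI := normal_range_toAdelic_line L dW
    haveI : CompactSpace (↥(UnitaryGroup.adelic ↥(maximalRealSubfield L) L (IsCMField.complexConj L) 1
        (Matrix.diagonal dW)) ⧸ (UnitaryGroup.toAdelic ↥(maximalRealSubfield L) L (IsCMField.complexConj L) 1
        (Matrix.diagonal dW)).range) := compactSpace_quotient_range_toAdelic_line L dW hdW hdW0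
    ∀ χ : PontryaginDual (↥(UnitaryGroup.adelic ↥(maximalRealSubfield L) L (IsCMField.complexConj L) 1
        (Matrix.diagonal dW)) ⧸ (UnitaryGroup.toAdelic ↥(maximalRealSubfield L) L (IsCMField.complexConj L) 1
        (Matrix.diagonal dW)).range),
      ∫ q, star (charCM χ q) *
          (cmThetaKernelDatum L e dV hdV hdV0 dW hdW hdW0 hGR hρ SK hSK).thetaLiftT ν Φ F q ∂μ =
        ∫ ξ, (cmThetaKernelDatum L e dV hdV hdV0 dW hdW hdW0 hGR hρ SK hSK).thetaLift μ Φ (charCM χ⁻¹) ξ * F ξ ∂ν := by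
  haveI := normal_range_toAdelic_line L dW
  haveI : CompactSpace (↥(UnitaryGroup.adelic ↥(maximalRealSubfield L) L (IsCMField.complexConj L) 1 (Matrix.diagonal dW)) ⧸
      (UnitaryGroup.toAdelic ↥(maximalRealSubfield L) L (IsCMField.complexConj L) 1 (Matrix.diagonal dW)).range) :=
    compactSpace_quotient_range_toAdelic_line L dW hdW hdW0
  intro χ
  exact ThetaKernelDatum.integral_star_charCM_mul_thetaLiftT
    (cmThetaKernelDatum L e dV hdV hdV0 dW hdW hdW0 hGR hρ SK hSK) μ ν Φ F χ

/-- **An automorphic character `χ` of the CM line OCCURS in the opposite theta lifts `Θᵗ_Φ(F)`,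
`F ∈ C([U(diag d_V)], ℂ)`, iff `Θ_Φ(χ⁻¹) ≠ 0`** (`ν` charging open sets). [cite: GelbartRogawski1991, §3.2 p. 457;
FleigEtAl2018, §12.3 Definition 12.5 (12.37)–(12.38), p. 296] -/
theorem cmThetaKernelDatum_line_exists_fourierCoeff_thetaLiftT_ne_zero_iff
    [CompactSpace (↥(UnitaryGroup.adelic ↥(maximalRealSubfield L) L (IsCMField.complexConj L) N (Matrix.diagonal dV)) ⧸
      (UnitaryGroup.toAdelic ↥(maximalRealSubfield L) L (IsCMField.complexConj L) N (Matrix.diagonal dV)).range)]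
    [MeasurableSpace (↥(UnitaryGroup.adelic ↥(maximalRealSubfield L) L (IsCMField.complexConj L) N (Matrix.diagonal dV)) ⧸
      (UnitaryGroup.toAdelic ↥(maximalRealSubfield L) L (IsCMField.complexConj L) N (Matrix.diagonal dV)).range)]
    [BorelSpace (↥(UnitaryGroup.adelic ↥(maximalRealSubfield L) L (IsCMField.complexConj L) N (Matrix.diagonal dV)) ⧸
      (UnitaryGroup.toAdelic ↥(maximalRealSubfield L) L (IsCMField.complexConj L) N (Matrix.diagonal dV)).range)]
    (ν : Measure (↥(UnitaryGroup.adelic ↥(maximalRealSubfield L) L (IsCMField.complexConj L) N (Matrix.diagonal dV)) ⧸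
      (UnitaryGroup.toAdelic ↥(maximalRealSubfield L) L (IsCMField.complexConj L) N (Matrix.diagonal dV)).range))
    [IsFiniteMeasure ν] [ν.IsOpenPosMeasure]
    [MeasurableSpace (↥(UnitaryGroup.adelic ↥(maximalRealSubfield L) L (IsCMField.complexConj L) 1 (Matrix.diagonal dW)) ⧸
      (UnitaryGroup.toAdelic ↥(maximalRealSubfield L) L (IsCMField.complexConj L) 1 (Matrix.diagonal dW)).range)]
    [BorelSpace (↥(UnitaryGroup.adelic ↥(maximalRealSubfield L) L (IsCMField.complexConj L) 1 (Matrix.diagonal dW)) ⧸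
      (UnitaryGroup.toAdelic ↥(maximalRealSubfield L) L (IsCMField.complexConj L) 1 (Matrix.diagonal dW)).range)]
    (μ : Measure (↥(UnitaryGroup.adelic ↥(maximalRealSubfield L) L (IsCMField.complexConj L) 1 (Matrix.diagonal dW)) ⧸
      (UnitaryGroup.toAdelic ↥(maximalRealSubfield L) L (IsCMField.complexConj L) 1 (Matrix.diagonal dW)).range))
    [IsFiniteMeasure μ] (Φ : piSchwartzBruhat ↥(maximalRealSubfield L) (Fin n)) :
    haveI := normal_range_toAdelic_line L dW
    haveI : CompactSpace (↥(UnitaryGroup.adelic ↥(maximalRealSubfield L) L (IsCMField.complexConj L) 1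
        (Matrix.diagonal dW)) ⧸ (UnitaryGroup.toAdelic ↥(maximalRealSubfield L) L (IsCMField.complexConj L) 1
        (Matrix.diagonal dW)).range) := compactSpace_quotient_range_toAdelic_line L dW hdW hdW0
    ∀ χ : PontryaginDual (↥(UnitaryGroup.adelic ↥(maximalRealSubfield L) L (IsCMField.complexConj L) 1
        (Matrix.diagonal dW)) ⧸ (UnitaryGroup.toAdelic ↥(maximalRealSubfield L) L (IsCMField.complexConj L) 1
        (Matrix.diagonal dW)).range),
      (∃ F : C(↥(UnitaryGroup.adelic ↥(maximalRealSubfield L) L (IsCMField.complexConj L) N (Matrix.diagonal dV)) ⧸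
          (UnitaryGroup.toAdelic ↥(maximalRealSubfield L) L (IsCMField.complexConj L) N (Matrix.diagonal dV)).range, ℂ),
        ∫ q, star (charCM χ q) *
          (cmThetaKernelDatum L e dV hdV hdV0 dW hdW hdW0 hGR hρ SK hSK).thetaLiftT ν Φ F q ∂μ ≠ 0) ↔
      (cmThetaKernelDatum L e dV hdV hdV0 dW hdW hdW0 hGR hρ SK hSK).thetaLift μ Φ (charCM χ⁻¹) ≠ 0 := by
  haveI := normal_range_toAdelic_line L dW
  haveI : CompactSpace (↥(UnitaryGroup.adelic ↥(maximalRealSubfield L) L (IsCMField.complexConj L) 1 (Matrix.diagonal dW)) ⧸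
      (UnitaryGroup.toAdelic ↥(maximalRealSubfield L) L (IsCMField.complexConj L) 1 (Matrix.diagonal dW)).range) :=
    compactSpace_quotient_range_toAdelic_line L dW hdW hdW0
  intro χ
  exact ThetaKernelDatum.exists_integral_star_charCM_mul_thetaLiftT_ne_zero_iff
    (cmThetaKernelDatum L e dV hdV hdV0 dW hdW hdW0 hGR hρ SK hSK) μ ν Φ χ

/-- **MODULO `hGR` ONLY: SOME AUTOMORPHIC CHARACTER OF THE CM LINE OCCURS IN THE THETA LIFTS OF THE GAUSSIAN LEVEL
FROM `[U(diag d_V)]`.**  For the CM pair `(U(diag d_V), U(⟨d_W⟩))` with `d_V` of Picard type at `ι₁` (`h₁V`, `hV`;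
`[U(diag d_V)]` compact — binder fed by `compactSpace_quotient_range_toAdelic_of_signs` / `…_of_four_le_finrank`),
finite Borel measures `ν` on `[U(diag d_V)]` and `μ` on `[U(⟨d_W⟩)]` charging open sets: there are a continuous
unitary character `χ` of `[U(⟨d_W⟩)]` and `F ∈ C([U(diag d_V)], ℂ)` with
`∫ conj χ(q) · Θᵗ_{Φ_G}(F)(q) dμ(q) ≠ 0` — by Fourier duality from the character `χ₀` with `Θ_{Φ_G}(χ₀)(1̄) ≠ 0` of
`cmThetaKernelDatum_line_exists_character_thetaLift_gaussSB_ne_zero` (`χ = χ₀⁻¹`).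
[cite: GelbartRogawski1991, §3.2 p. 457; FleigEtAl2018, §12.3 Definition 12.5 (12.37)–(12.38), p. 296;
DeitmarEchterhoff2014, Prop. 3.5.2] -/
theorem cmThetaKernelDatum_line_exists_character_fourierCoeff_thetaLiftT_gaussSB_ne_zero (ι₁ : L →+* ℂ)
    (h₁V : ∃ i₀ : Fin N, (∀ i, i ≠ i₀ → 0 < (ι₁ (dV i)).re) ∨ ∀ i, i ≠ i₀ → (ι₁ (dV i)).re < 0)
    (hV : ∀ τ : L →+* ℂ, InfinitePlace.mk τ ≠ InfinitePlace.mk ι₁ →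
      (∀ i, 0 < (τ (dV i)).re) ∨ ∀ i, (τ (dV i)).re < 0)
    [CompactSpace (↥(UnitaryGroup.adelic ↥(maximalRealSubfield L) L (IsCMField.complexConj L) N (Matrix.diagonal dV)) ⧸
      (UnitaryGroup.toAdelic ↥(maximalRealSubfield L) L (IsCMField.complexConj L) N (Matrix.diagonal dV)).range)]
    [MeasurableSpace (↥(UnitaryGroup.adelic ↥(maximalRealSubfield L) L (IsCMField.complexConj L) N (Matrix.diagonal dV)) ⧸
      (UnitaryGroup.toAdelic ↥(maximalRealSubfield L) L (IsCMField.complexConj L) N (Matrix.diagonal dV)).range)]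
    [BorelSpace (↥(UnitaryGroup.adelic ↥(maximalRealSubfield L) L (IsCMField.complexConj L) N (Matrix.diagonal dV)) ⧸
      (UnitaryGroup.toAdelic ↥(maximalRealSubfield L) L (IsCMField.complexConj L) N (Matrix.diagonal dV)).range)]
    (ν : Measure (↥(UnitaryGroup.adelic ↥(maximalRealSubfield L) L (IsCMField.complexConj L) N (Matrix.diagonal dV)) ⧸
      (UnitaryGroup.toAdelic ↥(maximalRealSubfield L) L (IsCMField.complexConj L) N (Matrix.diagonal dV)).range))
    [IsFiniteMeasure ν] [ν.IsOpenPosMeasure]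
    [MeasurableSpace (↥(UnitaryGroup.adelic ↥(maximalRealSubfield L) L (IsCMField.complexConj L) 1 (Matrix.diagonal dW)) ⧸
      (UnitaryGroup.toAdelic ↥(maximalRealSubfield L) L (IsCMField.complexConj L) 1 (Matrix.diagonal dW)).range)]
    [BorelSpace (↥(UnitaryGroup.adelic ↥(maximalRealSubfield L) L (IsCMField.complexConj L) 1 (Matrix.diagonal dW)) ⧸
      (UnitaryGroup.toAdelic ↥(maximalRealSubfield L) L (IsCMField.complexConj L) 1 (Matrix.diagonal dW)).range)]
    (μ : Measure (↥(UnitaryGroup.adelic ↥(maximalRealSubfield L) L (IsCMField.complexConj L) 1 (Matrix.diagonal dW)) ⧸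
      (UnitaryGroup.toAdelic ↥(maximalRealSubfield L) L (IsCMField.complexConj L) 1 (Matrix.diagonal dW)).range))
    [IsFiniteMeasure μ] [μ.IsOpenPosMeasure] :
    haveI := normal_range_toAdelic_line L dW
    haveI : CompactSpace (↥(UnitaryGroup.adelic ↥(maximalRealSubfield L) L (IsCMField.complexConj L) 1
        (Matrix.diagonal dW)) ⧸ (UnitaryGroup.toAdelic ↥(maximalRealSubfield L) L (IsCMField.complexConj L) 1
        (Matrix.diagonal dW)).range) := compactSpace_quotient_range_toAdelic_line L dW hdW hdW0
    ∃ (χ : PontryaginDual (↥(UnitaryGroup.adelic ↥(maximalRealSubfield L) L (IsCMField.complexConj L) 1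
        (Matrix.diagonal dW)) ⧸ (UnitaryGroup.toAdelic ↥(maximalRealSubfield L) L (IsCMField.complexConj L) 1
        (Matrix.diagonal dW)).range))
      (F : C(↥(UnitaryGroup.adelic ↥(maximalRealSubfield L) L (IsCMField.complexConj L) N (Matrix.diagonal dV)) ⧸
        (UnitaryGroup.toAdelic ↥(maximalRealSubfield L) L (IsCMField.complexConj L) N (Matrix.diagonal dV)).range, ℂ)),
      ∫ q, star (charCM χ q) *
        (cmThetaKernelDatum L e dV hdV hdV0 dW hdW hdW0 hGR
            (hasThetaMajorants_cmPairSplitting_of_signs_one L e dV hdV hdV0 dW hdW hdW0 ι₁ hGR h₁V hV) Set.univ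
            (fun _ _ _ => Set.mem_univ _)).thetaLiftT ν (gaussSB ↥(maximalRealSubfield L) n) F q ∂μ ≠ 0 := by
  haveI := normal_range_toAdelic_line L dW
  haveI : CompactSpace (↥(UnitaryGroup.adelic ↥(maximalRealSubfield L) L (IsCMField.complexConj L) 1 (Matrix.diagonal dW)) ⧸
      (UnitaryGroup.toAdelic ↥(maximalRealSubfield L) L (IsCMField.complexConj L) 1 (Matrix.diagonal dW)).range) :=
    compactSpace_quotient_range_toAdelic_line L dW hdW hdW0
  obtain ⟨χ₀, hχ₀⟩ :=
    cmThetaKernelDatum_line_exists_character_thetaLift_gaussSB_ne_zero L e dV hdV hdV0 dW hdW hdW0 ι₁ hGR h₁V hV μ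
  refine ⟨χ₀⁻¹, ThetaKernelDatum.exists_integral_star_charCM_mul_thetaLiftT_ne_zero _ μ ν ?_⟩
  rw [inv_inv]
  exact fun h0 => hχ₀ (by rw [h0]; rfl)

/-- **MODULO `hGR` ONLY: THE OPPOSITE THETA CORRESPONDENCE `Θᵗ_{Φ_G} : C([U(diag d_V)], ℂ) → C([U(⟨d_W⟩)], ℂ)` OF THE
CM PAIR IS NOT IDENTICALLY ZERO** — `Θᵗ_{Φ_G}(F) ≠ 0` for some continuous `F` on `[U(diag d_V)]` (same hypotheses):
FGKP's question "Is `Θ_{φ'}` non-zero?" for the lift (12.38) from `U(diag d_V)` to the CM line `U(⟨d_W⟩)`, at the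
Gaussian level. [cite: GelbartRogawski1991, §3.2 p. 457; FleigEtAl2018, §12.3 Definition 12.5 (12.38), p. 296;
DeitmarEchterhoff2014, Prop. 3.5.2] -/
theorem cmThetaKernelDatum_line_exists_thetaLiftT_gaussSB_ne_zero (ι₁ : L →+* ℂ)
    (hV : ∀ τ : L →+* ℂ, InfinitePlace.mk τ ≠ InfinitePlace.mk ι₁ →
      (∀ i, 0 < (τ (dV i)).re) ∨ ∀ i, (τ (dV i)).re < 0)
    (h₁V : ∃ i₀ : Fin N, (∀ i, i ≠ i₀ → 0 < (ι₁ (dV i)).re) ∨ ∀ i, i ≠ i₀ → (ι₁ (dV i)).re < 0)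
    [CompactSpace (↥(UnitaryGroup.adelic ↥(maximalRealSubfield L) L (IsCMField.complexConj L) N (Matrix.diagonal dV)) ⧸
      (UnitaryGroup.toAdelic ↥(maximalRealSubfield L) L (IsCMField.complexConj L) N (Matrix.diagonal dV)).range)]
    [MeasurableSpace (↥(UnitaryGroup.adelic ↥(maximalRealSubfield L) L (IsCMField.complexConj L) N (Matrix.diagonal dV)) ⧸
      (UnitaryGroup.toAdelic ↥(maximalRealSubfield L) L (IsCMField.complexConj L) N (Matrix.diagonal dV)).range)]
    [BorelSpace (↥(UnitaryGroup.adelic ↥(maximalRealSubfield L) L (IsCMField.complexConj L) N (Matrix.diagonal dV)) ⧸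
      (UnitaryGroup.toAdelic ↥(maximalRealSubfield L) L (IsCMField.complexConj L) N (Matrix.diagonal dV)).range)]
    (ν : Measure (↥(UnitaryGroup.adelic ↥(maximalRealSubfield L) L (IsCMField.complexConj L) N (Matrix.diagonal dV)) ⧸
      (UnitaryGroup.toAdelic ↥(maximalRealSubfield L) L (IsCMField.complexConj L) N (Matrix.diagonal dV)).range))
    [IsFiniteMeasure ν] [ν.IsOpenPosMeasure] :
    haveI := normal_range_toAdelic_line L dW
    haveI : CompactSpace (↥(UnitaryGroup.adelic ↥(maximalRealSubfield L) L (IsCMField.complexConj L) 1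
        (Matrix.diagonal dW)) ⧸ (UnitaryGroup.toAdelic ↥(maximalRealSubfield L) L (IsCMField.complexConj L) 1
        (Matrix.diagonal dW)).range) := compactSpace_quotient_range_toAdelic_line L dW hdW hdW0
    ∃ F : C(↥(UnitaryGroup.adelic ↥(maximalRealSubfield L) L (IsCMField.complexConj L) N (Matrix.diagonal dV)) ⧸
        (UnitaryGroup.toAdelic ↥(maximalRealSubfield L) L (IsCMField.complexConj L) N (Matrix.diagonal dV)).range, ℂ),
      (cmThetaKernelDatum L e dV hdV hdV0 dW hdW hdW0 hGR
          (hasThetaMajorants_cmPairSplitting_of_signs_one L e dV hdV hdV0 dW hdW hdW0 ι₁ hGR h₁V hV) Set.univ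
          (fun _ _ _ => Set.mem_univ _)).thetaLiftT ν (gaussSB ↥(maximalRealSubfield L) n) F ≠ 0 := by
  haveI := normal_range_toAdelic_line L dW
  haveI : CompactSpace (↥(UnitaryGroup.adelic ↥(maximalRealSubfield L) L (IsCMField.complexConj L) 1 (Matrix.diagonal dW)) ⧸
      (UnitaryGroup.toAdelic ↥(maximalRealSubfield L) L (IsCMField.complexConj L) 1 (Matrix.diagonal dW)).range) :=
    compactSpace_quotient_range_toAdelic_line L dW hdW hdW0
  letI : MeasurableSpace (↥(UnitaryGroup.adelic ↥(maximalRealSubfield L) L (IsCMField.complexConj L) 1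
      (Matrix.diagonal dW)) ⧸ (UnitaryGroup.toAdelic ↥(maximalRealSubfield L) L (IsCMField.complexConj L) 1
      (Matrix.diagonal dW)).range) := borel _
  haveI : BorelSpace (↥(UnitaryGroup.adelic ↥(maximalRealSubfield L) L (IsCMField.complexConj L) 1
      (Matrix.diagonal dW)) ⧸ (UnitaryGroup.toAdelic ↥(maximalRealSubfield L) L (IsCMField.complexConj L) 1
      (Matrix.diagonal dW)).range) := ⟨rfl⟩
  obtain ⟨χ₀, hχ₀⟩ :=
    cmThetaKernelDatum_line_exists_character_thetaLift_gaussSB_ne_zero L e dV hdV hdV0 dW hdW hdW0 ι₁ hGR h₁V hV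
      Measure.haar
  exact ThetaKernelDatum.exists_thetaLiftT_ne_zero _ Measure.haar ν fun h0 => hχ₀ (by rw [h0]; rfl)

end Line

/-! ### Build-lane note
As in the lineage (ops-buildfix G11b-3): the public theorems whose statements unfold to the theta-kernel data are tagged
`[implicit_reducible]` only to keep them out of the library-suggestion index computed at `.olean` export. -/
set_option allowUnsafeReducibility true in
attribute [implicit_reducible]
  cmThetaKernelDatum_thetaLinear
  cmThetaKernelDatum_line_thetaLift_cmPairRep_charCM
  cmThetaKernelDatum_line_thetaLift_cmPairRep_sub_smul_charCM
  cmThetaKernelDatum_line_integral_star_charCM_mul_thetaLiftT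
  cmThetaKernelDatum_line_exists_fourierCoeff_thetaLiftT_ne_zero_iff
  cmThetaKernelDatum_line_exists_character_fourierCoeff_thetaLiftT_gaussSB_ne_zero
  cmThetaKernelDatum_line_exists_thetaLiftT_gaussSB_ne_zero

end UnitaryDualPair

end Literature.NumberTheory.GelbartRogawski1991

end
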